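import Mathlib
import Summits.Ventures.PercRepro2.K5Marks
import Summits.Ventures.PercRepro2.K5TypedK3Five

/-!
# (HCOV) on every five-vertex graph at every marking, and on the 5-cycle
(blind cell PercRepro2, typer-1 g48)

`K5TypedK3Five.lean` (typer-1 g10) states row 2′TRI and (HCOV) on a loop-free graph without parallel
edges on five vertices through an equivalence `ι : V ≃ Fin 5` sending the marks to `0, …, 4`
(`typedBases_five` / `HCov_five`); `K5Marks.lean` (typer-1 g9) builds that equivalence from five
distinct marks alone (`exists_equiv_of_five`).  The two are put together here:

* **`typedBases_card5`** / **`HCov_card5`**: row 2′TRI, resp. (HCOV) for every admissible weight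
  vector, on EVERY loop-free graph without parallel edges with exactly five vertices, for every
  choice of five distinct marks — ten inequalities, no order hypothesis;
* **`typedBases_cycle5`** / **`HCov_cycle5`**: row 2′TRI and (HCOV) on the 5-cycle
  `cyc5 i = s(i, i + 1)` (`V = E = Fin 5`) for every admissible weight vector and every placement
  of the five distinct marks — the base case `C₅` of the cycle theorem (LEAD-CYCLES.md §1 / §6 (1);
  S3 (C7)), in the kernel WITHOUT the 24 closed forms: all 120 placements are instances of the `K₅`
  certificate `cert3_4` along the pattern map of `K5TypedSimple.lean`;
* **`ZDelta_cycle5`**: the crux of record `ZDelta` on `C₅` for every admissible weight vector with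
  `P(a₁ ↔ b) ≤ P(a₂ ↔ b)`.
-/

namespace Summit.Ventures.PercRepro2

namespace K5

section Card5

variable {V E : Type*} [Fintype V] [DecidableEq V] [Fintype E] [DecidableEq E]
variable {R : Type*} [Field R] [LinearOrder R] [IsStrictOrderedRing R]

/-- **Row 2′TRI on every loop-free graph without parallel edges on exactly five vertices**, every
five distinct marks, all minors. -/
theorem typedBases_card5 (hV : Fintype.card V = 5) (ends : E → Sym2 V)
    (hloop : ∀ e, ¬ (ends e).IsDiag) (hinj : Function.Injective ends)
    (o a₁ a₂ a₃ b : V) (h01 : o ≠ a₁) (h02 : o ≠ a₂) (h03 : o ≠ a₃) (h04 : o ≠ b)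
    (h12 : a₁ ≠ a₂) (h13 : a₁ ≠ a₃) (h14 : a₁ ≠ b) (h23 : a₂ ≠ a₃) (h24 : a₂ ≠ b) (h34 : a₃ ≠ b) :
    CovForm.TypedBases (R := R) ends o a₁ a₂ a₃ b := by
  obtain ⟨ι, h0, h1, h2, h3, h4⟩ :=
    exists_equiv_of_five hV o a₁ a₂ a₃ b h01 h02 h03 h04 h12 h13 h14 h23 h24 h34
  exact typedBases_five ι ends hloop hinj o a₁ a₂ a₃ b h0 h1 h2 h3 (Or.inl h4)

/-- **(HCOV) on every loop-free graph without parallel edges on exactly five vertices**, every five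
distinct marks, every admissible weight vector. -/
theorem HCov_card5 (hV : Fintype.card V = 5) (ends : E → Sym2 V)
    (hloop : ∀ e, ¬ (ends e).IsDiag) (hinj : Function.Injective ends)
    (o a₁ a₂ a₃ b : V) (h01 : o ≠ a₁) (h02 : o ≠ a₂) (h03 : o ≠ a₃) (h04 : o ≠ b)
    (h12 : a₁ ≠ a₂) (h13 : a₁ ≠ a₃) (h14 : a₁ ≠ b) (h23 : a₂ ≠ a₃) (h24 : a₂ ≠ b) (h34 : a₃ ≠ b)
    (p : E → R) (hp : IsProbVec p) : CovForm.HCov p ends o a₁ a₂ a₃ b :=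
  CovForm.HCov_of_typedBases ends o a₁ a₂ a₃ b
    (typedBases_card5 hV ends hloop hinj o a₁ a₂ a₃ b h01 h02 h03 h04 h12 h13 h14 h23 h24 h34) p hp

end Card5

end K5

/-! ## The 5-cycle -/

namespace Cycle5

/-- The 5-cycle on the vertices `0, …, 4`: edge `i` joins `i` and `i + 1` (mod 5). -/
def cyc5 : Fin 5 → Sym2 (Fin 5) := fun i => s(i, i + 1)

/-- The 5-cycle has no loops. -/
lemma cyc5_not_isDiag : ∀ e, ¬ (cyc5 e).IsDiag := by
  decide

/-- The 5-cycle has no parallel edges. -/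
lemma cyc5_injective : Function.Injective cyc5 := by
  intro i j hij
  revert hij
  revert i j
  decide

section Theorems

variable {R : Type*} [Field R] [LinearOrder R] [IsStrictOrderedRing R]

/-- **Row 2′TRI on the 5-cycle at every placement of five distinct marks**, all minors. -/
theorem typedBases_cycle5 (o a₁ a₂ a₃ b : Fin 5) (h01 : o ≠ a₁) (h02 : o ≠ a₂) (h03 : o ≠ a₃)
    (h04 : o ≠ b) (h12 : a₁ ≠ a₂) (h13 : a₁ ≠ a₃) (h14 : a₁ ≠ b) (h23 : a₂ ≠ a₃) (h24 : a₂ ≠ b)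
    (h34 : a₃ ≠ b) : CovForm.TypedBases (R := R) cyc5 o a₁ a₂ a₃ b :=
  K5.typedBases_card5 (by simp) cyc5 cyc5_not_isDiag cyc5_injective o a₁ a₂ a₃ b
    h01 h02 h03 h04 h12 h13 h14 h23 h24 h34

/-- **(HCOV) on the 5-cycle** for every admissible weight vector and every placement of the five
distinct marks (the base case `C₅` of the cycle theorem, LEAD-CYCLES.md §1, without its 24 closed
forms). -/
theorem HCov_cycle5 (p : Fin 5 → R) (hp : IsProbVec p) (o a₁ a₂ a₃ b : Fin 5) (h01 : o ≠ a₁)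
    (h02 : o ≠ a₂) (h03 : o ≠ a₃) (h04 : o ≠ b) (h12 : a₁ ≠ a₂) (h13 : a₁ ≠ a₃) (h14 : a₁ ≠ b)
    (h23 : a₂ ≠ a₃) (h24 : a₂ ≠ b) (h34 : a₃ ≠ b) : CovForm.HCov p cyc5 o a₁ a₂ a₃ b :=
  CovForm.HCov_of_typedBases cyc5 o a₁ a₂ a₃ b
    (typedBases_cycle5 o a₁ a₂ a₃ b h01 h02 h03 h04 h12 h13 h14 h23 h24 h34) p hp

/-- **The crux of record on the 5-cycle**: `ZDelta` for every admissible weight vector with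
`P(a₁ ↔ b) ≤ P(a₂ ↔ b)`, every placement of the five distinct marks. -/
theorem ZDelta_cycle5 (p : Fin 5 → R) (hp : IsProbVec p) (o a₁ a₂ a₃ b : Fin 5) (h01 : o ≠ a₁)
    (h02 : o ≠ a₂) (h03 : o ≠ a₃) (h04 : o ≠ b) (h12 : a₁ ≠ a₂) (h13 : a₁ ≠ a₃) (h14 : a₁ ≠ b)
    (h23 : a₂ ≠ a₃) (h24 : a₂ ≠ b) (h34 : a₃ ≠ b)
    (hord : prob p (connEvent cyc5 a₁ b) ≤ prob p (connEvent cyc5 a₂ b)) :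
    ZDelta p cyc5 o a₁ a₂ a₃ b :=
  CovForm.ZDelta_of_typedBases cyc5
    (typedBases_cycle5 o a₁ a₂ a₃ b h01 h02 h03 h04 h12 h13 h14 h23 h24 h34) p hp hord

end Theorems

end Cycle5

end Summit.Ventures.PercRepro2
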